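import Summits.RiemannHypothesis.RiemannHypothesis.Theorems.ScrewFejerWindowSecondDiffLandau
import Summits.RiemannHypothesis.RiemannHypothesis.Theses.ScrewFejerWindow
import HarnessLib

/-!
# Crux `ScrewFejerWindow.WindowLandau` (stmt-RiemannHypothesis-23967) — the Fejér-window Landau
criterion for Suzuki's screw function (RH-free, K1 of route `ScrewFejerWindow`, L48)

**Theorem (`WindowLandau_proof`).**  Let `Ψ = zetaScrew` be Suzuki's screw function of `ζ`
(Suzuki 2023, J. Lond. Math. Soc. 108, arXiv:2206.03682, (1.1)).  If for ONE lag `τ > 0` the second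
differences are bounded below on the half-line, `Ψ(t + 2τ) − 2Ψ(t + τ) + Ψ(t) ≥ −K` for all `t ≥ 0`,
then the Riemann Hypothesis holds.

This is a NEW RH-CRITERION, not a proof of RH: the hypothesis (the route's residual conjunct
`WindowFloor`, stmt-RiemannHypothesis-23968) is RH-implied and, given this theorem, RH-equivalent.
RH is NOT proved by this file; nothing here bears on the truth of RH.

**Proof** = the RH-free engine `ScrewFejerWindow.riemannHypothesis_of_secondDiff_zetaScrew_ge`
(`Theorems/ScrewFejerWindowSecondDiffLandau.lean`): Landau's lemma (Montgomery–Vaughan Lemma 15.1)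
for the non-negative back-shifted combination
`g(y) = Ψ(log y) − 2·𝟙_{y>e^τ}Ψ(log y − τ) + 𝟙_{y>e^{2τ}}Ψ(log y − 2τ) + K`, whose Mellin transform
is `(1 − e^{-τs})² s^{-2} (ξ'/ξ)(1/2 + s) + K/s` — the factor `(1 − e^{-τs})²` kills the real
singularity at `s = 0` and does not vanish in `Re s > 0` — followed by the identity-theorem /
order-of-vanishing step of Suzuki2023 §7.2 (tree `ZetaScrewThm17Proofs`).
-/

-- `Summit.RiemannHypothesis.RiemannHypothesis.…` repeats a component by the tree's layout (D-0017).
set_option linter.dupNamespace false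

noncomputable section

namespace Summit.RiemannHypothesis.RiemannHypothesis.Theorems

open Literature.NumberTheory.LFunctions

/-- **Crux `ScrewFejerWindow.WindowLandau` (stmt-RiemannHypothesis-23967), the Fejér-window Landau
criterion (RH-free):** if for some lag `τ > 0` and some `K` the second differences of Suzuki's screw
function satisfy `Ψ(t + 2τ) − 2Ψ(t + τ) + Ψ(t) ≥ −K` for all `t ≥ 0`, then the Riemann Hypothesis
holds (`ScrewFejerWindow.riemannHypothesis_of_secondDiff_zetaScrew_ge`: Landau's lemma for the
transform `(1 − e^{-τs})² s^{-2} (ξ'/ξ)(1/2 + s) + K/s` of the non-negative back-shifted combination).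
A criterion, not a proof of RH: the floor itself is the RH-equivalent residual `WindowFloor`.
Nothing here bears on the truth of RH. -/
theorem WindowLandau_proof :
    Summit.RiemannHypothesis.RiemannHypothesis.Theses.ScrewFejerWindow.WindowLandau := by
  unfold Summit.RiemannHypothesis.RiemannHypothesis.Theses.ScrewFejerWindow.WindowLandau
  rintro ⟨τ, hτ, K, hfloor⟩
  show _root_.RiemannHypothesis
  exact ScrewFejerWindow.riemannHypothesis_of_secondDiff_zetaScrew_ge hτ hfloor

end Summit.RiemannHypothesis.RiemannHypothesis.Theorems

end
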